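import Mathlib.NumberTheory.NumberField.Discriminant.Different
import Literature.NumberTheory.EllipticCurves.PAdicGrossZagier
import Literature.NumberTheory.EllipticCurves.BSDHeegnerPoints
import Literature.NumberTheory.EllipticCurves.PAdicLFunctionInterpolationHoldsProofs
import Literature.NumberTheory.EllipticCurves.QuadraticTwistProofs
import Literature.NumberTheory.EllipticCurves.LFunctionSmulProofs
import Literature.NumberTheory.EllipticCurves.GlobalMinimalModelProofs
import Literature.NumberTheory.EllipticCurves.AnalyticRankModularityProofs
import Literature.NumberTheory.EllipticCurves.ModularSymbolsCompletedLProofs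
import Literature.NumberTheory.DiophantineGeometry.LocalReductionFiniteBadPlacesProofs
import Literature.NumberTheory.QuadraticFields.HeegnerCondition
import HarnessLib

/-!
# The constant term of `L_p(E/K, T)` vanishes when `L(E/K, 1) = 0` (first clause of
# Perrin-Riou's `p`-adic Gross–Zagier theorem, proved)

Trunk T-NT-EC (Literature/NumberTheory/EllipticCurves); companion PROOF file of
`PAdicGrossZagier.lean` (named fact `Literature.NumberTheory.EllipticCurves.perrinRiou_padicGrossZagier`, Perrin-Riou 1987, Thm. 1.3)
and of the barrier `Literature.Barriers.BirchSwinnertonDyer.PAdicHeightBarrier`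
(`Literature/Barriers/BirchSwinnertonDyer/PAdicHeightNondegeneracy.lean`).

Perrin-Riou's theorem (B. Perrin-Riou, *Points de Heegner et dérivées de fonctions `L`
`p`-adiques*, Invent. Math. 89 (1987), Thm. 1.3) has two clauses: the `p`-adic `L`-function of
`E` over the imaginary quadratic field `K` VANISHES at the trivial character, and its derivative
there is a non-zero multiple of the `p`-adic height of the Heegner point. The first clause is
elementary given the interpolation property: "The Heegner hypothesis forces the constant term
`L_{f,0}` to vanish" (B. Howard, *The Iwasawa theoretic Gross–Zagier theorem*, Compos. Math. 141
(2005), Thm. 1 and the sentence following it), because the sign of the functional equation of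
`L(E/K, s)` is then `-1`, so `L(E/K, 1) = 0`, and `L_p(E/K, 0)` is an explicit multiple of
`L(E/K, 1)` (Mazur–Tate–Teitelbaum 1986, §I.14, (14.3) at the trivial character:
`L_p(E, 0) = (1 - α⁻¹)² L(E, 1)/Ω⁺`).

This file PROVES the first clause for the tree's objects, in the form

* `Literature.NumberTheory.EllipticCurves.constantCoeff_padicLFunctionEK_eq_zero`: for `E/ℚ` (globally minimal `W`) with newform
  `f`, `g` the newform of the quadratic twist `E^{(d_K)}`, `p` an odd prime of good ordinary
  reduction which splits in the quadratic field `K`, if `L(E, 1) · L(E^{(d_K)}, 1) = 0` (the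
  tree's `L(E/K, 1)`, cf. `Literature.NumberTheory.EllipticCurves.analyticRankEK`) then the cyclotomic `p`-adic `L`-function
  `L_p(E/K, T) = L_p(f, α, T) · L_p(g, α, T)` (`Literature.NumberTheory.EllipticCurves.padicLFunctionEK`) has constant term `0`;
* `Literature.NumberTheory.EllipticCurves.constantCoeff_padicLFunctionEK_eq_zero_of_analyticRankEK_ne_zero`,
  `Literature.NumberTheory.EllipticCurves.one_le_order_padicLFunctionEK_of_analyticRankEK_ne_zero`: the same from
  `ord_{s=1} L(E/K, s) ≥ 1` (in particular in the analytic-rank-one situation of the barrier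
  `PAdicHeightBarrier`), and `Literature.NumberTheory.EllipticCurves.constantCoeff_padicLFunctionEK_eq_zero_of_heegner`: the same
  from the Heegner hypothesis, relative to the named fact `Literature.NumberTheory.EllipticCurves.one_le_analyticRankEK`
  (sign of the functional equation; Gross 1984, §5).

So the only part of `perrinRiou_padicGrossZagier` that remains a named fact in the analytic-rank-one
regime is the derivative clause (`coeff_1 L_p(E/K) = 0 ↔ ⟨P_K, P_K⟩_p = 0`).

## Proof

`L_p(E/K, T) = L_p(f, α, T) · L_p(g, α, T)` for `p` split (`padicLFunctionEK_of_split`), so the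
constant term is the product of the two constant terms. For `f` the interpolation property
(`isPAdicLFunctionOf_padicLFunction_holds`, Mazur–Tate–Teitelbaum (14.3)) gives
`L_p(f, α, 0) = (1 - α⁻¹)² [0]⁺_f` with `[0]⁺_f = re L(f, 1)/Ω⁺_f` (`normalizedPlusSymbol_zero_holds`)
and `L(f, s) = L(E, s)` (`IsNewformOf`), so `L(E, 1) = 0 ⇒ L_p(f, α, 0) = 0`. For the twist the
same argument needs the distribution relation of the measure `μ_{g,α}` with the SAME unit root
`α` of `E`, i.e. `a_p(g) = a_p(E)`: we pass to a global minimal model `W'` of `E^{(d_K)}`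
(`hasGlobalMinimalModel_rat_holds`; `IsNewformOf` is invariant, `LFunction_smul`), which has good
reduction at `p` because the twisted equation is `p`-integral with `p`-unit discriminant
(`WeierstrassCurve.hasGoodReductionAt_quadraticTwist`, Silverman VII.1 Remark 1.1), and use the
twisting formula `a_p(W') = (d/p) a_p(W)` (`frobeniusTrace_quadraticTwist_holds`, Knapp Prop. 12.10)
with `(d_K/p) = 1` for `p` split in `K` (`isSquare_discr_of_ncard_primesOver_eq_two`: `d_K` is a
square modulo `4p`, `Literature.NumberTheory.QuadraticFields.Quadratic.exists_dvd_sq_sub_discr_of_ncard_primesOver`, and `p ∤ d_K`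
because a split prime is unramified, Mathlib's `NumberField.not_dvd_discr_iff_isUnramifiedIn`).
Since `frobeniusTrace_quadraticTwist` is stated for squarefree `d`, we write `d_K = d₀ b²` with
`d₀` squarefree and use `E^{(d₀ b²)} ≅ E^{(d₀)}` (`exists_variableChange_quadraticTwist_mul_sq`).

## References

* B. Perrin-Riou, Invent. Math. 89 (1987), Thm. 1.3 (first clause). [cite: PerrinRiou1987, Thm. 1.3]
* B. Howard, Compos. Math. 141 (2005), Thm. 1 ("The Heegner hypothesis forces the constant term
  `L_{f,0}` to vanish").
* B. Mazur, J. Tate, J. Teitelbaum, Invent. Math. 84 (1986), §I.14 (14.3).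
* A. W. Knapp, *Elliptic Curves* (1993), Prop. 12.10; J. H. Silverman, *AEC* (2009), VII.1
  Remark 1.1, VII.5 Prop. 5.1.
-/

noncomputable section

open scoped MatrixGroups ModularForm Classical

open CongruenceSubgroup NumberField IsDedekindDomain Filter Topology

/-! ### Local facts on Weierstrass equations over `ℚ` (dot-notation extensions of `WeierstrassCurve`) -/

namespace WeierstrassCurve

open Rat.HeightOneSpectrum IsDedekindDomain.HeightOneSpectrum

variable (W : WeierstrassCurve ℚ) [W.IsGloballyMinimal]

/-- **The twisted equation has good reduction away from `2 d Δ`.** For a globally minimal `W/ℚ`,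
an integer `d` and a finite place `v` of `ℚ` over a prime `p ∤ 2d` with `p ∤ Δ_min(W)`, the model
`W^d : y² = x³ + d(b₂/4)x² + d²(b₄/2)x + d³(b₆/4)` (`WeierstrassCurve.quadraticTwist`) is
`v`-integral with `v`-unit discriminant `d⁶ Δ_min(W)`, hence has good reduction at `v`
(Silverman, *AEC* VII.1, Remark 1.1 and VII.5, Prop. 5.1(a); the valuations are computed exactly as
in `frobeniusTrace_quadraticTwist_holds`). Dot-notation extension of Mathlib's `WeierstrassCurve`
namespace. [cite: SilvermanAEC2009, VII.1 Remark 1.1 and VII.5 Prop. 5.1(a)] -/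
theorem hasGoodReductionAt_quadraticTwist (v : HeightOneSpectrum (𝓞 ℚ)) {d : ℤ}
    (hpd : ¬ ((primesEquiv v : ℕ) : ℤ) ∣ 2 * d)
    (hgood : ¬ ((primesEquiv v : ℕ) : ℤ) ∣ minimalDiscriminantInt W) :
    (W.quadraticTwist (d : ℚ)).HasGoodReductionAt v := by
  have hpP : (primesEquiv v : ℕ).Prime := (primesEquiv v).2
  have hpZ : Prime ((primesEquiv v : ℕ) : ℤ) := Nat.prime_iff_prime_int.mp hpP
  have hp2 : ¬ ((primesEquiv v : ℕ) : ℤ) ∣ 2 := fun h ↦ hpd (h.mul_right d)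
  have hpd' : ¬ ((primesEquiv v : ℕ) : ℤ) ∣ d := fun h ↦ hpd (dvd_mul_of_dvd_right h 2)
  have hp4 : ¬ ((primesEquiv v : ℕ) : ℤ) ∣ 4 := fun h ↦
    (hpZ.dvd_or_dvd (show ((primesEquiv v : ℕ) : ℤ) ∣ 2 * 2 by norm_num; exact h)).elim hp2 hp2
  set M : WeierstrassCurve ℤ := integralModelInt W with hM
  have hWM : M.map (Int.castRingHom ℚ) = W := map_integralModelInt W
  have hWb₂ : W.b₂ = (M.b₂ : ℚ) := by rw [← congrArg WeierstrassCurve.b₂ hWM, map_b₂, eq_intCast]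
  have hWb₄ : W.b₄ = (M.b₄ : ℚ) := by rw [← congrArg WeierstrassCurve.b₄ hWM, map_b₄, eq_intCast]
  have hWb₆ : W.b₆ = (M.b₆ : ℚ) := by rw [← congrArg WeierstrassCurve.b₆ hWM, map_b₆, eq_intCast]
  have hv4 : v.valuation ℚ (4 : ℚ) = 1 := by
    have h := valuation_ringOfIntegers_intCast_eq_one v (n := 4) (by exact_mod_cast hp4)
    simpa using h
  have hv2 : v.valuation ℚ (2 : ℚ) = 1 := by
    have h := valuation_ringOfIntegers_intCast_eq_one v (n := 2) (by exact_mod_cast hp2)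
    simpa using h
  have hvd : v.valuation ℚ (d : ℚ) = 1 := valuation_ringOfIntegers_intCast_eq_one v hpd'
  have hvΔ : v.valuation ℚ W.Δ = 1 := by
    rw [← cast_minimalDiscriminantInt]
    exact valuation_ringOfIntegers_intCast_eq_one v hgood
  have hvb₂ : v.valuation ℚ W.b₂ ≤ 1 := hWb₂ ▸ valuation_ringOfIntegers_intCast_le_one v _
  have hvb₄ : v.valuation ℚ W.b₄ ≤ 1 := hWb₄ ▸ valuation_ringOfIntegers_intCast_le_one v _
  have hvb₆ : v.valuation ℚ W.b₆ ≤ 1 := hWb₆ ▸ valuation_ringOfIntegers_intCast_le_one v _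
  refine hasGoodReductionAt_of_valuation_le_one_of_valuation_Δ_eq_one
    (v := v) (W := W.quadraticTwist (d : ℚ)) ?_ ?_ ?_ ?_ ?_ ?_
  · simp
  · simp only [quadraticTwist_a₂, map_div₀, map_mul, hv4, hvd, div_one, one_mul]
    exact hvb₂
  · simp
  · simp only [quadraticTwist_a₄, map_div₀, map_mul, map_pow, hv2, hvd, div_one, one_mul, one_pow]
    exact hvb₄
  · simp only [quadraticTwist_a₆, map_div₀, map_mul, map_pow, hv4, hvd, div_one, one_mul, one_pow]
    exact hvb₆
  · simp only [quadraticTwist_Δ, map_mul, map_pow, hvd, one_pow, one_mul, hvΔ]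

/-- **Good reduction at `p` means `p ∤ Δ_min`** for a globally minimal `W/ℚ`: the model-independent
predicate `HasGoodReductionAtPrime` (the `ℤ_p`-minimal model of `W/ℚ_p` has unit discriminant)
forces `p ∤ minimalDiscriminantInt W`, because `W/ℚ_v` is itself minimal at the place `v` over
`p`, and two minimal equations have discriminants of the same valuation (Silverman, *AEC* VII.1,
Prop. 1.3(b) and VII.5, Prop. 5.1(a)). Converse of `hasGoodReductionAtPrime_of_not_dvd`.
Dot-notation extension of Mathlib's `WeierstrassCurve` namespace.
[cite: SilvermanAEC2009, VII.5 Prop. 5.1(a) and VII.1 Prop. 1.3(b)] -/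
theorem not_dvd_minimalDiscriminantInt_of_hasGoodReductionAtPrime (p : ℕ) [Fact p.Prime]
    (hW : W.HasGoodReductionAtPrime p) : ¬ (p : ℤ) ∣ minimalDiscriminantInt W := by
  obtain ⟨v, rfl⟩ : ∃ v : HeightOneSpectrum (𝓞 ℚ), (primesEquiv v : ℕ) = p :=
    ⟨primesEquiv.symm ⟨p, Fact.out⟩, by rw [Equiv.apply_symm_apply]⟩
  intro hdvd
  have hgood : W.HasGoodReductionAt v :=
    (hasGoodReductionAtPrime_iff_hasGoodReductionAt_ringOfIntegers v W).mp hW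
  -- the chosen local minimal model and `W_v` are both minimal, so `v(Δ(W_v))` is a unit
  obtain ⟨E, hE⟩ : ∃ E : VariableChange (v.adicCompletion ℚ),
      W.localMinimalModel v = E • W.baseChange (v.adicCompletion ℚ) := ⟨_, rfl⟩
  haveI hmin : (W.baseChange (v.adicCompletion ℚ)).IsMinimal (v.adicCompletionIntegers ℚ) :=
    IsGloballyMinimal.isMinimal v
  haveI : (E • W.baseChange (v.adicCompletion ℚ)).IsMinimal (v.adicCompletionIntegers ℚ) :=
    hE ▸ inferInstance
  have h1 := ((hasGoodReduction_iff (v.adicCompletionIntegers ℚ) (W.localMinimalModel v)).mp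
    hgood).2
  rw [hE, valuation_Δ_smul_eq_of_isMinimal (v.adicCompletionIntegers ℚ)
    (W.baseChange (v.adicCompletion ℚ)) E] at h1
  -- `Δ(W_v) = Δ_min(W)`, an integer divisible by `p`, is not a `v`-adic unit
  have hΔ : (W.baseChange (v.adicCompletion ℚ)).Δ =
      algebraMap ℚ (v.adicCompletion ℚ) (minimalDiscriminantInt W : ℚ) := by
    rw [cast_minimalDiscriminantInt]; exact W.map_Δ _
  have hle : v.valuation ℚ (minimalDiscriminantInt W : ℚ) ≤ 1 :=
    valuation_ringOfIntegers_intCast_le_one v _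
  have hne : v.valuation ℚ (minimalDiscriminantInt W : ℚ) ≠ 1 := by
    haveI := Fact.mk (primesEquiv v).2
    rw [Ne, (valuation_equiv_padicValuation v).eq_one_iff_eq_one, Rat.padicValuation_cast,
      Int.padicValuation_eq_one_iff]
    exact fun h ↦ h hdvd
  have hlt : v.valuation ℚ (minimalDiscriminantInt W : ℚ) < 1 := lt_of_le_of_ne hle hne
  -- the integer `Δ_min(W)` as an element of `O_v` is a non-unit
  set x : v.adicCompletion ℚ := algebraMap ℚ (v.adicCompletion ℚ) (minimalDiscriminantInt W : ℚ)
    with hx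
  have hvx : Valued.v x < 1 := by rw [hx, valued_algebraMap]; exact hlt
  have hxeq : x = algebraMap (v.adicCompletionIntegers ℚ) (v.adicCompletion ℚ) ⟨x, hvx.le⟩ := rfl
  rw [hΔ, hxeq, valuation_eq_one_iff_notMem] at h1
  apply h1
  change (⟨x, hvx.le⟩ : v.adicCompletionIntegers ℚ) ∈ IsLocalRing.maximalIdeal _
  rw [IsLocalRing.mem_maximalIdeal, mem_nonunits_iff,
    adicCompletionIntegers.isUnit_iff_valued_eq_one]
  exact hvx.ne

end WeierstrassCurve

/-! ### Split primes of a quadratic field -/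

namespace Literature.NumberTheory.EllipticCurves

open ModularForms WeierstrassCurve

section SplitPrime

variable {K : Type*} [Field K] [NumberField K]

/-- **A totally split prime is unramified, hence prime to the discriminant.** If the rational
prime `p` has `[K : ℚ]` primes of `𝓞 K` above it, then `p ∤ d_K`: each prime above `p` has
ramification index `1` (`Literature.NumberTheory.QuadraticFields.SplitPrime.ramificationIdx_eq_one_of_ncard_primesOver`, the
fundamental identity), so `p` is unramified in `𝓞 K`, which by Dedekind's discriminant theorem
(Mathlib `NumberField.not_dvd_discr_iff_isUnramifiedIn`) means `p ∤ d_K` (Marcus, *Number Fields*,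
Ch. 3, Thm. 24; Neukirch, *Algebraic Number Theory*, III.2.12). [folklore] -/
theorem not_dvd_discr_of_ncard_primesOver {p : ℕ} (hp : p.Prime)
    (h : ((Ideal.span {(p : ℤ)}).primesOver (𝓞 K)).ncard = Module.finrank ℚ K) :
    ¬ (p : ℤ) ∣ NumberField.discr K := by
  have hpZ : Prime (p : ℤ) := Nat.prime_iff_prime_int.mp hp
  rw [NumberField.not_dvd_discr_iff_isUnramifiedIn K (𝓞 K) hpZ,
    Algebra.isUnramifiedIn_iff_forall_ramificationIdx_eq_one]
  intro P _ hP
  have hmem : P ∈ (Ideal.span {(p : ℤ)}).primesOver (𝓞 K) := ⟨‹P.IsPrime›, hP⟩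
  have he := (Literature.NumberTheory.QuadraticFields.SplitPrime.ramificationIdx_eq_one_of_ncard_primesOver hp h hmem).1
  rwa [Ideal.ramificationIdx'_eq_ramificationIdx (Ideal.span {(p : ℤ)}) P
    (by simpa using hpZ.ne_zero)] at he

/-- **At a prime split in the quadratic field `K`, `d_K` is a non-zero square modulo `p`**, i.e.
the Kronecker symbol `(d_K/p)` is `1`: `d_K ≡ β² (mod 4p)` by the Heegner condition at level `p`
(`Literature.NumberTheory.QuadraticFields.Quadratic.exists_dvd_sq_sub_discr_of_ncard_primesOver`; Gross 1984, §3), and `p ∤ d_K`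
since a split prime is unramified (`not_dvd_discr_of_ncard_primesOver`) (Marcus, *Number Fields*,
Ch. 3, Thm. 25: `p` splits in the quadratic field of discriminant `d` iff `(d/p) = 1`, for odd
`p ∤ d`). [folklore] -/
theorem isSquare_discr_of_ncard_primesOver_eq_two (h2 : Module.finrank ℚ K = 2) {p : ℕ}
    (hp : p.Prime) (h : ((Ideal.span {(p : ℤ)}).primesOver (𝓞 K)).ncard = 2) :
    IsSquare ((NumberField.discr K : ℤ) : ZMod p) ∧ ((NumberField.discr K : ℤ) : ZMod p) ≠ 0 := by
  haveI : NeZero p := ⟨hp.ne_zero⟩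
  refine ⟨?_, fun h0 ↦ not_dvd_discr_of_ncard_primesOver hp (h.trans h2.symm)
    ((ZMod.intCast_zmod_eq_zero_iff_dvd _ p).mp h0)⟩
  obtain ⟨β, hβ⟩ := Literature.NumberTheory.QuadraticFields.Quadratic.exists_dvd_sq_sub_discr_of_ncard_primesOver h2 hp.ne_zero
    (fun q hq hqp ↦ by rwa [(Nat.prime_dvd_prime_iff_eq hq hp).mp hqp])
  have hp' : (p : ℤ) ∣ β ^ 2 - NumberField.discr K := (Dvd.intro_left 4 rfl).trans hβ
  have h0 := (ZMod.intCast_zmod_eq_zero_iff_dvd _ p).mpr hp'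
  push_cast at h0
  exact ⟨(β : ZMod p), by linear_combination -h0⟩

end SplitPrime

/-! ### The twist: transport of `IsNewformOf`, and the constant term of `L_p(g, α, T)` -/

section Twist

variable {W : WeierstrassCurve ℚ} [W.IsElliptic] {N : ℕ} [NeZero N] {g : CuspForm (Gamma0 N) 2}

/-- `IsNewformOf` is invariant under admissible changes of variables of the curve: the Dirichlet
coefficients `aₙ(W)` of Mathlib's `WeierstrassCurve.LFunction` are isomorphism invariants
(`WeierstrassCurve.LFunction_smul`; Silverman, *AEC* App. C §16). [folklore] -/
theorem isNewformOf_smul_iff (C : VariableChange ℚ) :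
    IsNewformOf (C • W) g ↔ IsNewformOf W g := by
  simp only [IsNewformOf, WeierstrassCurve.LFunction_smul]

omit [W.IsElliptic] in
/-- **`L(E, 1) = 0 ⇒ [0]⁺_f = 0`.** If `f` is the newform of `W` (any Weierstrass model over `ℚ`)
and the entire `L`-function of `W` vanishes at `s = 1`, then the rational plus symbol
`[0]⁺_f = ratPlusSymbol f 0` vanishes: `L(W, s)` IS entire (Hecke, via
`hasEntireLFunction_of_cuspCoeff_eq`) and equals `L(f, s)`, and `[0]⁺_f = re L(f, 1) / Ω⁺_f`
(`normalizedPlusSymbol_zero_holds`; Mazur–Tate–Teitelbaum 1986, §I.8 (8.6): `[0]⁺ = L(f,1)/Ω⁺`).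
[cite: MazurTateTeitelbaum1986Invent, §I.8 (8.6)] -/
theorem ratPlusSymbol_zero_eq_zero_of_entireLFunction_eq_zero (hg : IsNewformOf W g)
    (hL : W.entireLFunction 1 = 0) : ratPlusSymbol g 0 = 0 := by
  have hE : W.HasEntireLFunction :=
    WeierstrassCurve.hasEntireLFunction_of_cuspCoeff_eq (strictWidthInfty_Gamma0 _) W g hg.2
  have hreal : ∀ n, (cuspCoeff g n).im = 0 := fun n ↦ by rw [hg.2 n]; exact Complex.intCast_im _
  have h0 : normalizedPlusSymbol g 0 = 0 := by
    rw [normalizedPlusSymbol_zero_holds g hreal (W.differentiable_entireLFunction hE)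
      (fun s hs ↦ by rw [W.entireLFunction_eq_LSeries hE (by linarith), hg.cuspFormLSeries_eq]),
      hL, Complex.zero_re, zero_div]
  have hex : ∃ q : ℚ, (q : ℝ) = normalizedPlusSymbol g 0 := ⟨0, by rw [h0, Rat.cast_zero]⟩
  rw [ratPlusSymbol, dif_pos hex]
  exact_mod_cast (hex.choose_spec.trans h0 : ((hex.choose : ℚ) : ℝ) = 0)

variable [W.IsGloballyMinimal] {p : ℕ} [Fact p.Prime]

/-- **The constant term of `L_p(g, α, T)` for the newform `g` of a quadratic twist `E^{(d)}` and
the unit root `α` OF `E`**, at an odd good ordinary prime `p` with `(d/p) = 1`: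
`L_p(g, α, 0) = (1 - α⁻¹)² [0]⁺_g` (Mazur–Tate–Teitelbaum 1986, §I.14 (14.3) at the trivial
character, for `g`). The point is that `α` is also the unit root of `E^{(d)}`:
`a_p(E^{(d)}) = (d/p) a_p(E) = a_p(E)` (`frobeniusTrace_quadraticTwist_holds`, Knapp Prop. 12.10,
applied to a global minimal model `W'` of the twist, `hasGlobalMinimalModel_rat_holds`, after
reducing to squarefree `d₀` with `d = d₀ b²`, `exists_variableChange_quadraticTwist_mul_sq`; `W'`
has good reduction at `p`, `hasGoodReductionAt_quadraticTwist`), so the distribution relation of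
`μ_{g,α}` holds (`sum_fiber_msdMeasure_succ_eq`, with Manin–Drinfeld for `g`,
`exists_nsmul_modularSymbol_mem_periodLattice_of_isNewformOf`, and `p ∤` level,
`not_dvd_level_of_isNewformOf`), and the Riemann sums for the constant term are constant
(`padicLRiemannSum_zero`). [cite: MazurTateTeitelbaum1986Invent, §I.14 (14.3)] -/
theorem constantCoeff_padicLFunction_twist {d : ℤ} (hd : d ≠ 0) (hp2 : p ≠ 2)
    (hleg : legendreSym p d = 1) (hord : IsOrdinaryAt W p)
    (hg : IsNewformOf (W.quadraticTwist (d : ℚ)) g) :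
    PowerSeries.constantCoeff (padicLFunction g (unitRoot W p : ℚ_[p])) =
      (1 - (unitRoot W p : ℚ_[p])⁻¹) ^ 2 * (ratPlusSymbol g 0 : ℚ_[p]) := by
  have hpP : p.Prime := Fact.out
  have hpZ : Prime (p : ℤ) := Nat.prime_iff_prime_int.mp hpP
  -- `p ∤ d`, `p ∤ 2d`, `p ∤ Δ_min(W)`
  have hpd : ¬ (p : ℤ) ∣ d := fun h ↦ by
    rw [(legendreSym.eq_zero_iff p d).mpr ((ZMod.intCast_zmod_eq_zero_iff_dvd d p).mpr h)] at hleg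
    exact zero_ne_one hleg
  have hp2' : ¬ (p : ℤ) ∣ 2 := fun h ↦ hp2 <| by
    have := Int.le_of_dvd two_pos h
    have := hpP.two_le
    omega
  have h2d : ¬ (p : ℤ) ∣ 2 * d := fun h ↦ (hpZ.dvd_or_dvd h).elim hp2' hpd
  have hΔ : ¬ (p : ℤ) ∣ minimalDiscriminantInt W :=
    W.not_dvd_minimalDiscriminantInt_of_hasGoodReductionAtPrime p hord.1
  -- squarefree part: `d = d₀ b²`
  obtain ⟨a, b, ha, hb, hab, hsq⟩ := Nat.sq_mul_squarefree_of_pos (Int.natAbs_pos.mpr hd)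
  set d₀ : ℤ := d.sign * a with hd₀
  have hdd : d = d₀ * (b : ℤ) ^ 2 := by
    have h1 : (d.natAbs : ℤ) = (b : ℤ) ^ 2 * a := by exact_mod_cast hab.symm
    calc d = d.sign * (d.natAbs : ℤ) := (Int.sign_mul_natAbs d).symm
      _ = d₀ * (b : ℤ) ^ 2 := by rw [h1, hd₀]; ring
  have hd₀sq : Squarefree d₀ := by
    rw [← Int.squarefree_natAbs, hd₀, Int.natAbs_mul, Int.natAbs_sign_of_ne_zero hd, one_mul,
      Int.natAbs_natCast]
    exact hsq
  have hb0 : (b : ℚ) ≠ 0 := by exact_mod_cast hb.ne'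
  have hpb : ¬ (p : ℤ) ∣ b := fun h ↦ hpd (by rw [hdd]; exact (h.pow two_ne_zero).mul_left _)
  have hleg₀ : legendreSym p d₀ = 1 := by
    have hbp : ((b : ℤ) : ZMod p) ≠ 0 := fun h ↦ hpb ((ZMod.intCast_zmod_eq_zero_iff_dvd _ p).mp h)
    rw [hdd, legendreSym.mul, legendreSym.sq_one' p hbp, mul_one] at hleg
    exact hleg
  -- the twisted model, a global minimal model `W'` of it, and `W' ≅ W^{d₀}`
  set X : WeierstrassCurve ℚ := W.quadraticTwist (d : ℚ) with hX
  haveI hXell : X.IsElliptic := W.isElliptic_quadraticTwist (by exact_mod_cast hd)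
  obtain ⟨C, hC⟩ := hasGlobalMinimalModel_rat_holds X
  haveI := hC
  have hg' : IsNewformOf (C • X) g := (isNewformOf_smul_iff C).mpr hg
  obtain ⟨C₁, hC₁⟩ := W.exists_variableChange_quadraticTwist_mul_sq (d₀ : ℚ) (b : ℚ) hb0
  have hXd₀ : X = C₁ • W.quadraticTwist (d₀ : ℚ) := by
    rw [hC₁, hX, hdd]; push_cast; rfl
  have hiso : ∃ C' : VariableChange ℚ, C' • (C • X) = W.quadraticTwist (d₀ : ℚ) :=
    ⟨C₁⁻¹ * C⁻¹, by rw [mul_smul, inv_smul_smul, hXd₀, inv_smul_smul]⟩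
  -- good reduction of `W' = C • X` at `p`
  obtain ⟨v, hv⟩ : ∃ v : HeightOneSpectrum (𝓞 ℚ), (Rat.HeightOneSpectrum.primesEquiv v : ℕ) = p :=
    ⟨Rat.HeightOneSpectrum.primesEquiv.symm ⟨p, hpP⟩, by rw [Equiv.apply_symm_apply]⟩
  have hgoodX : (C • X).HasGoodReductionAtPrime p := by
    subst hv
    rw [hasGoodReductionAtPrime_iff_hasGoodReductionAt_ringOfIntegers v (C • X),
      hasGoodReductionAt_smul_iff_holds v X C]
    exact W.hasGoodReductionAt_quadraticTwist v h2d hΔ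
  -- `a_p(g) = a_p(W') = (d₀/p) a_p(W) = a_p(W)`
  have hap : cuspCoeff g p = ((W.frobeniusTrace p : ℤ) : ℂ) := by
    rw [cuspCoeff_eq_frobeniusTrace_of_isNewformOf_holds hg' hgoodX,
      frobeniusTrace_quadraticTwist_holds W (C • X) d₀ hd₀sq hiso p
        (fun h ↦ (hpZ.dvd_or_dvd h).elim hp2' fun h' ↦ hpd (by rw [hdd]; exact h'.mul_right _)) hΔ,
      hleg₀, one_mul]
  -- distribution relation for `μ_{g,α}` and the constant Riemann sums
  obtain ⟨hαeq, -, hα0⟩ := unitRoot_coe_spec (W := W) hord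
  have hdist := fun n a ↦ sum_fiber_msdMeasure_succ_eq
    (ratCast_ratPlusSymbol_of_maninDrinfeld
      (exists_nsmul_modularSymbol_mem_periodLattice_of_isNewformOf hg'))
    hg.1 (not_dvd_level_of_isNewformOf hg' hgoodX) hap hα0 hαeq n a
  rw [constantCoeff_padicLFunction, padicLCoeff,
    (tendsto_const_nhds.congr fun n ↦ (padicLRiemannSum_zero hdist n).symm).limUnder_eq]

end Twist

/-! ### The constant term of `L_p(E/K, T)` -/

section ConstantTerm

variable (W : WeierstrassCurve ℚ) [W.IsElliptic] [W.IsGloballyMinimal] (p : ℕ) [Fact p.Prime]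
  (K : Type*) [Field K] [NumberField K]
  {Nf Ng : ℕ} [NeZero Nf] [NeZero Ng] {f : CuspForm (Gamma0 Nf) 2} {g : CuspForm (Gamma0 Ng) 2}
  (hf : IsNewformOf W f) (hg : IsNewformOf (W.quadraticTwist (NumberField.discr K : ℚ)) g)

/-- **`L(E/K, 1) = 0 ⇒ L_p(E/K, 0) = 0`** (Perrin-Riou 1987, Thm. 1.3, first clause, in the tree's
normalisation; Howard 2005, Thm. 1: "the constant term `L_{f,0}` vanish[es]"). Let `E/ℚ` have
globally minimal model `W`, newform `f`, and let `g` be the newform of the twist `E^{(d_K)}` by the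
discriminant of the quadratic field `K` (`[K : ℚ] = 2`); let `p` be an odd prime of good ordinary
reduction for `E` which splits in `K`. If `L(E, 1) · L(E^{(d_K)}, 1) = 0` then the cyclotomic
`p`-adic `L`-function `L_p(E/K, T) = L_p(f, α, T) L_p(g, α, T)` has constant term `0`: by the
interpolation property (Mazur–Tate–Teitelbaum 1986, (14.3)) the constant term is
`(1 - α⁻¹)⁴ [0]⁺_f [0]⁺_g` with `[0]⁺ = re L(·, 1)/Ω⁺`. [cite: PerrinRiou1987, Thm. 1.3] -/
theorem constantCoeff_padicLFunctionEK_eq_zero (hp2 : p ≠ 2) (hgood : W.HasGoodReductionAtPrime p)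
    (hord : ¬ (p : ℤ) ∣ W.frobeniusTrace p) (h2 : Module.finrank ℚ K = 2)
    (hsplit : ((Ideal.span {(p : ℤ)}).primesOver (𝓞 K)).ncard = 2)
    (hL : W.entireLFunction 1 *
      (W.quadraticTwist (NumberField.discr K : ℚ)).entireLFunction 1 = 0) :
    PowerSeries.constantCoeff (padicLFunctionEK W p K hf hg) = 0 := by
  have hordW : IsOrdinaryAt W p := ⟨hgood, hord⟩
  obtain ⟨hsq, hne⟩ := isSquare_discr_of_ncard_primesOver_eq_two h2 Fact.out hsplit
  have hleg : legendreSym p (NumberField.discr K) = 1 := (legendreSym.eq_one_iff p hne).mpr hsq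
  rw [padicLFunctionEK_of_split W p K hf hg hsplit, map_mul,
    (isPAdicLFunctionOf_padicLFunction_holds hordW hf).1,
    constantCoeff_padicLFunction_twist (NumberField.discr_ne_zero K) hp2 hleg hordW hg]
  rcases mul_eq_zero.mp hL with h | h
  · rw [ratPlusSymbol_zero_eq_zero_of_entireLFunction_eq_zero hf h]
    simp
  · rw [ratPlusSymbol_zero_eq_zero_of_entireLFunction_eq_zero hg h]
    simp

omit [W.IsElliptic] [W.IsGloballyMinimal] in
/-- `ord_{s=1} L(E/K, s) ≥ 1 ⇒ L(E, 1) · L(E^{(d_K)}, 1) = 0`: a function of positive analytic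
order at `1` vanishes there (`Literature.NumberTheory.EllipticCurves.analyticRankEK` is the order of vanishing of the product of
the entire `L`-functions; Mathlib `analyticOrderAt_ne_zero`). [folklore] -/
theorem entireLFunction_mul_eq_zero_of_analyticRankEK_ne_zero (h : EllipticCurves.analyticRankEK W K ≠ 0) :
    W.entireLFunction 1 * (W.quadraticTwist (NumberField.discr K : ℚ)).entireLFunction 1 = 0 := by
  have h' : analyticOrderAt (fun s ↦ W.entireLFunction s *
      (W.quadraticTwist (NumberField.discr K : ℚ)).entireLFunction s) 1 ≠ 0 := fun h0 ↦
    h (by rw [EllipticCurves.analyticRankEK, analyticOrderNatAt, h0, ENat.toNat_zero])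
  exact (analyticOrderAt_ne_zero.mp h').2

/-- **In positive analytic rank over `K`, `L_p(E/K, T)` vanishes at `T = 0`** (Perrin-Riou 1987,
Thm. 1.3, first clause, for the tree's `padicLFunctionEK`): under the hypotheses of
`constantCoeff_padicLFunctionEK_eq_zero`, `ord_{s=1} L(E/K, s) ≠ 0` implies
`constantCoeff L_p(E/K, T) = 0`. This is the first conjunct of the named fact
`Literature.NumberTheory.EllipticCurves.perrinRiou_padicGrossZagier` in the analytic-rank-one regime of the barrier
`Literature.Barriers.BirchSwinnertonDyer.PAdicHeightBarrier`, now a theorem. [cite: PerrinRiou1987, Thm. 1.3] -/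
theorem constantCoeff_padicLFunctionEK_eq_zero_of_analyticRankEK_ne_zero (hp2 : p ≠ 2)
    (hgood : W.HasGoodReductionAtPrime p) (hord : ¬ (p : ℤ) ∣ W.frobeniusTrace p)
    (h2 : Module.finrank ℚ K = 2) (hsplit : ((Ideal.span {(p : ℤ)}).primesOver (𝓞 K)).ncard = 2)
    (hr : EllipticCurves.analyticRankEK W K ≠ 0) :
    PowerSeries.constantCoeff (padicLFunctionEK W p K hf hg) = 0 :=
  constantCoeff_padicLFunctionEK_eq_zero W p K hf hg hp2 hgood hord h2 hsplit
    (entireLFunction_mul_eq_zero_of_analyticRankEK_ne_zero W K hr)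

/-- `ord_{T=0} L_p(E/K, T) ≥ 1` in positive analytic rank over `K` (the `PowerSeries.order` form
of `constantCoeff_padicLFunctionEK_eq_zero_of_analyticRankEK_ne_zero`; Perrin-Riou 1987, Thm. 1.3,
first clause). [cite: PerrinRiou1987, Thm. 1.3] -/
theorem one_le_order_padicLFunctionEK_of_analyticRankEK_ne_zero (hp2 : p ≠ 2)
    (hgood : W.HasGoodReductionAtPrime p) (hord : ¬ (p : ℤ) ∣ W.frobeniusTrace p)
    (h2 : Module.finrank ℚ K = 2) (hsplit : ((Ideal.span {(p : ℤ)}).primesOver (𝓞 K)).ncard = 2)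
    (hr : EllipticCurves.analyticRankEK W K ≠ 0) :
    (1 : ℕ∞) ≤ (padicLFunctionEK W p K hf hg).order := by
  refine PowerSeries.nat_le_order _ 1 fun i hi ↦ ?_
  obtain rfl : i = 0 := by omega
  rw [PowerSeries.coeff_zero_eq_constantCoeff_apply]
  exact constantCoeff_padicLFunctionEK_eq_zero_of_analyticRankEK_ne_zero W p K hf hg hp2 hgood hord
    h2 hsplit hr

/-- **Under the Heegner hypothesis `L_p(E/K, 0) = 0`**, relative to the named fact
`Literature.NumberTheory.EllipticCurves.one_le_analyticRankEK` (the sign of the functional equation of `L(E/K, s)` is `-1`, so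
`ord_{s=1} L(E/K, s) ≥ 1`; Gross 1984, §5): this is literally the first clause of Perrin-Riou
1987, Thm. 1.3 / the first conjunct of `Literature.NumberTheory.EllipticCurves.perrinRiou_padicGrossZagier`, for `K` imaginary
quadratic satisfying the Heegner hypothesis for the conductor `N` of `E`, `p` odd good ordinary
and split ("The Heegner hypothesis forces the constant term `L_{f,0}` to vanish", Howard 2005,
after Thm. 1). [cite: PerrinRiou1987, Thm. 1.3] -/
theorem constantCoeff_padicLFunctionEK_eq_zero_of_heegner {N : ℕ} [NeZero N]
    (h1 : EllipticCurves.one_le_analyticRankEK W N K) (hp2 : p ≠ 2) (hgood : W.HasGoodReductionAtPrime p)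
    (hord : ¬ (p : ℤ) ∣ W.frobeniusTrace p) (hK : IsImaginaryQuadratic K)
    (hN : W.conductorNorm ℤ = N) (hH : SatisfiesHeegnerHypothesis N K)
    (hsplit : ((Ideal.span {(p : ℤ)}).primesOver (𝓞 K)).ncard = 2) :
    PowerSeries.constantCoeff (padicLFunctionEK W p K hf hg) = 0 :=
  constantCoeff_padicLFunctionEK_eq_zero_of_analyticRankEK_ne_zero W p K hf hg hp2 hgood hord hK.1
    hsplit (by have := h1 hK hN hH; omega)

end ConstantTerm

end Literature.NumberTheory.EllipticCurves

end
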